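import Summits.FinalStateConjecture.FinalStateConjecture.Theses.ZeroEnergyKerrOrBomb
import Summits.FinalStateConjecture.FinalStateConjecture.Theorems.ZeroEnergyKerrOrBombZeroEnergyRigidityStubFuturePresentationOpens
import Summits.FinalStateConjecture.FinalStateConjecture.Theorems.ZeroEnergyKerrOrBombZeroEnergyRigidityStubFuturePresentationFields
import Summits.FinalStateConjecture.FinalStateConjecture.Theorems.ZeroEnergyKerrOrBombZeroEnergyRigidityStubFuturePresentationPieces
import Literature.Geometry.Lorentzian.CauchyDevelopmentComap
import Literature.Geometry.Lorentzian.DataEmbeddingNormalSmooth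

/-!
# `ZeroEnergyRigidity`, line `global-horizon-killing-field` — stub `stub_futurePresentation`
# (S1b, main file): WLOG the carrier of a presentation is `I⁺(M_ext)`

Main file of stub S1b of the registered skeleton `Cruxes/ZeroEnergyRigidity/Lines/
global_horizon_killing_field_c1.lean` (crux stmt-FinalStateConjecture-10690) = residue S1b of the
census `KerrOrBomb.Census.kerrOrBomb_of_residues` (p110860, crux stmt-FinalStateConjecture-10689);
assembles the landed helpers `…StubFuturePresentation{Opens,Fields,Pieces}.lean` (p104174,
p105359, p105451) into the registered statement (reconstruction by the 10689 line lead c10 of the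
main file p106051 lost to a gate restart).

`FuturePresentation.futurePresentation 𝓑 = 𝓑⁺`: carrier `I⁺(M_ext)` (open, connected,
flow-invariant, left by no causal curve) with `g|`, `τ|`; slice the far piece `far (R + 1)` with
the pulled-back data and the transported end `{R + 1 < ‖x‖}` (same decay class); embedding
`ι ∘ incl` corestricted to `I⁺(M_ext)` with normal `ν ∘ incl` — the data-embedding fields of
`((dataEmbedding 𝓑).comapAlong incl …).restrict I⁺(M_ext) …`, the differentiability of `ν` along
`ι` being `DataEmbedding.mdifferentiableAt_embed_normal`; Killing field `T|`.  `M_ext⁺` read in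
`M` is the orbit of `ι(far (R + 2))`, a non-empty flow-invariant part of `M_ext`, so
`I^±(M_ext⁺) = I^±(M_ext)` in `M` and, in `𝓑⁺`, their preimages under the inclusion: hence
`doc⁺ = incl⁻¹ doc`, `𝓔⁺⁺ = incl⁻¹ 𝓔⁺`, `𝓑⁺` is future-presented and h1–h4 pass to `𝓑⁺`.

References: P. T. Chruściel, J. L. Costa, Astérisque 321 (2008) = arXiv:0806.0016, §2.1–2.2 and
§3 (Lemma 3.5); B. O'Neill, *Semi-Riemannian geometry* (1983), Ch. 3, p. 57 and Prop. 3.59,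
Ch. 14, Lemma 14.3, Cor. 14.1, p. 402; S. W. Hawking, G. F. R. Ellis (1973), §6.5–6.6;
R. Bartnik, CPAM 39 (1986), §1 and Def. 2.1.
-/

noncomputable section

set_option linter.dupNamespace false

namespace Summit.FinalStateConjecture.FinalStateConjecture.Theorems.ZeroEnergyRigidity.GlobalHorizonKillingField.FuturePresentation

open Set Function Filter TopologicalSpace Bundle Literature.Geometry.Lorentzian
open scoped Manifold ContDiff Topology

/-! ## The data-embedding part of a presentation; the far piece of the slice -/

/-- The data-embedding part `(M, g, τ, ι, ν)` of a presentation `𝓑` (the same five fields, read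
as a `DataEmbedding` of its initial data set `D` on the slice `X`). Chruściel–Costa 2008, §2.1. -/
abbrev dataEmbedding (𝓑 : StationaryAFBlackHole.{0}) : DataEmbedding 𝓑.D where
  toSpacetime := 𝓑.toSpacetime
  embed := 𝓑.embed
  isSmoothEmbedding := 𝓑.isSmoothEmbedding
  normal := 𝓑.normal
  isFutureUnitNormal := 𝓑.isFutureUnitNormal
  induced_h := 𝓑.induced_h
  induced_k := fun y ↦ 𝓑.induced_k y

/-- The far piece `Σ_ext' = far (R + 1)` of the slice of a presentation is connected (image of
`{R + 1 < ‖x‖} ⊆ ℝ³`). Bartnik 1986, §1. -/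
instance connectedSpace_farOpens_succ (𝓑 : StationaryAFBlackHole.{0}) :
    ConnectedSpace (𝓑.e.farOpens (𝓑.e.R + 1)) :=
  isConnected_iff_connectedSpace.mp
    ⟨far_nonempty 𝓑.e _, 𝓑.e.isPreconnected_far' (by linarith)⟩

variable (𝓑 : StationaryAFBlackHole.{0}) [𝓑.metric.HasLeviCivita]

/-- The sub-carrier `I⁺(M_ext)` as an open subset. O'Neill 1983, Ch. 14, Lemma 14.3. -/
abbrev futureOpens : Opens 𝓑.carrier :=
  ⟨𝓑.metric.chronologicalFuture 𝓑.timeOrientation 𝓑.Mext, isOpen_chronologicalFuture_Mext 𝓑⟩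

omit [𝓑.metric.HasLeviCivita] in
/-- The data `ι^*(h, k)` on the far piece `far (R + 1)` of the slice. Bartnik 1986, §1. -/
def farData : InitialDataSet (𝓡 3) (𝓑.e.farOpens (𝓑.e.R + 1)) :=
  𝓑.D.comap (Subtype.val : 𝓑.e.farOpens (𝓑.e.R + 1) → 𝓑.X)
    (InitialDataSet.contMDiff_subtypeVal_succ _) (InitialDataSet.injective_mfderiv_subtypeVal _)

omit [𝓑.metric.HasLeviCivita] in
/-- The end `{R + 1 < ‖x‖}` of the far piece, transported along the restricted chart. -/
def farEnd : AFEnd (𝓑.e.farOpens (𝓑.e.R + 1)) :=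
  (inclusionAFEnd (exteriorRegion (𝓑.e.R + 1)) (𝓑.e.R + 1)
      (𝓑.e.R_pos.trans_le (by linarith)) (fun _ h ↦ h)).comap
    (𝓑.e.restrictChart (R₁ := 𝓑.e.R + 1) (by linarith))

/-- The data embedding of the far piece: `(M, g, τ, ι ∘ incl, ν ∘ incl)`. -/
abbrev dataEmbeddingFar : DataEmbedding (farData 𝓑) :=
  (dataEmbedding 𝓑).comapAlong (Subtype.val : 𝓑.e.farOpens (𝓑.e.R + 1) → 𝓑.X)
    (InitialDataSet.contMDiff_subtypeVal_succ _) (InitialDataSet.injective_mfderiv_subtypeVal _)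
    (𝓑.e.farOpens (𝓑.e.R + 1)).2.isOpenEmbedding_subtypeVal
    (fun u ↦ (dataEmbedding 𝓑).mdifferentiableAt_embed_normal u.1)

/-- The embedded far piece lies in `I⁺(M_ext)`. -/
theorem embed_mem_futureOpens (y : 𝓑.e.farOpens (𝓑.e.R + 1)) :
    𝓑.embed y.1 ∈ futureOpens 𝓑 :=
  𝓑.Mext_subset_chronologicalFuture (𝓑.image_far_subset_Mext ⟨y.1, y.2, rfl⟩)

/-- The data embedding `(I⁺(M_ext), g|, τ|, ι ∘ incl, ν ∘ incl)` of the far piece. -/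
abbrev dataEmbeddingFuture : DataEmbedding (farData 𝓑) :=
  (dataEmbeddingFar 𝓑).restrict (futureOpens 𝓑) (isConnected_chronologicalFuture_Mext 𝓑)
    (fun y ↦ embed_mem_futureOpens 𝓑 y)
    ((dataEmbedding 𝓑).mdifferentiableAt_normal_comapAlong _ _ _ _)

/-- **The future re-presentation** `𝓑⁺` of `𝓑`: carrier `I⁺(M_ext)` with the restricted metric
and time orientation, slice the far piece `far (R + 1)` with the pulled-back data and the
transported end, Killing field `T|`. Chruściel–Costa 2008, §2.1–2.2. -/
abbrev futurePresentation : StationaryAFBlackHole.{0} where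
  toSpacetime :=
    -- the open sub-spacetime `(I⁺(M_ext), g|, τ|)` (= `(dataEmbeddingFuture 𝓑).toSpacetime`,
    -- written as a literal over `𝓑.carrier` so that all instances are those of `↥(futureOpens 𝓑)`)
    { carrier := futureOpens 𝓑
      metric := 𝓑.metric.restrict PseudoRiemannianMetric.contMDiff_restrict_holds (futureOpens 𝓑)
      timeOrientation := 𝓑.timeOrientation.restrict PseudoRiemannianMetric.contMDiff_restrict_holds
        𝓑.timeOrientation.contMDiff_restrict_holds (futureOpens 𝓑)
      connectedSpace := isConnected_iff_connectedSpace.mp (isConnected_chronologicalFuture_Mext 𝓑) }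
  X := 𝓑.e.farOpens (𝓑.e.R + 1)
  D := farData 𝓑
  e := farEnd 𝓑
  isAsymptoticallyFlat := by
    obtain ⟨α, hα, hAF⟩ := 𝓑.isAsymptoticallyFlat
    exact ⟨α, hα, isAsymptoticallyFlat_farEnd 𝓑.e 𝓑.D (by linarith) hAF⟩
  embed := fun y ↦ ⟨𝓑.embed y.1, embed_mem_futureOpens 𝓑 y⟩
  normal := fun y ↦ 𝓑.normal y.1
  isSmoothEmbedding := (dataEmbeddingFuture 𝓑).isSmoothEmbedding
  isFutureUnitNormal := (dataEmbeddingFuture 𝓑).isFutureUnitNormal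
  induced_h := (dataEmbeddingFuture 𝓑).induced_h
  induced_k := by
    intro inst y
    haveI : (dataEmbeddingFuture 𝓑).metric.HasLeviCivita := inst
    exact (dataEmbeddingFuture 𝓑).induced_k y
  killing := fun y ↦ 𝓑.killing y.1
  isStationary := by
    intro inst
    haveI : (𝓑.metric.restrict PseudoRiemannianMetric.contMDiff_restrict_holds
        (futureOpens 𝓑)).HasLeviCivita := inst
    refine ⟨isKillingField_restrict 𝓑 (futureOpens 𝓑) 𝓑.isStationaryKilling.isKillingField,
      fun y ↦ ?_, fun x hx ↦ ?_⟩
    · -- completeness: the orbit of `T` through a point of `I⁺(M_ext)` stays in `I⁺(M_ext)`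
      obtain ⟨γ, hγ, h0⟩ := 𝓑.isStationaryKilling.isCompleteVectorField y.1
      have hmem : ∀ t, γ t ∈ futureOpens 𝓑 := fun t ↦
        mem_chronologicalFuture_Mext_of_isMIntegralCurve 𝓑 hγ (by rw [h0]; exact y.2) t
      exact ⟨fun t ↦ ⟨γ t, hmem t⟩, isMIntegralCurve_codRestrict (futureOpens 𝓑) hγ hmem,
        Subtype.ext h0⟩
    · -- `M_ext⁺` read in `M` lies in `M_ext`
      obtain ⟨γ, hγ, ⟨y, hy, hγ0⟩, t, rfl⟩ := hx
      have hγ' : IsMIntegralCurve (Subtype.val ∘ γ) 𝓑.killing :=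
        (isMIntegralCurve_subtypeVal_comp_iff (futureOpens 𝓑)).2 hγ
      have h0 : (Subtype.val ∘ γ) 0 ∈ 𝓑.embed '' 𝓑.e.far (𝓑.e.R + 1) := by
        rw [Function.comp_apply, ← hγ0]
        exact ⟨y.1, y.2, rfl⟩
      have hMext : (γ t).1 ∈ 𝓑.Mext := mem_stationaryOrbit_of_isMIntegralCurve hγ' h0 t
      exact 𝓑.isStationaryKilling.2.2 _ hMext

/-! ## The future re-presentation read in `M` -/

/-- The standing Levi-Civita hypothesis for the metric of `𝓑⁺`. O'Neill 1983, Ch. 3, Thm. 3.11. -/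
instance hasLeviCivita_futurePresentation : (futurePresentation 𝓑).metric.HasLeviCivita :=
  (futurePresentation 𝓑).metric.toPseudoRiemannianMetric.hasLeviCivita

/-- The same instance in the syntactic form `g|_{I⁺(M_ext)}` met by the restriction lemmas. -/
instance hasLeviCivita_restrict_futureOpens : (𝓑.metric.restrict
    PseudoRiemannianMetric.contMDiff_restrict_holds (futureOpens 𝓑)).HasLeviCivita :=
  hasLeviCivita_futurePresentation 𝓑

omit [𝓑.metric.HasLeviCivita] in
/-- No causal curve leaves `I⁺(M_ext)` (push-up). O'Neill 1983, Ch. 14, Cor. 14.1. -/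
theorem futureOpens_causallyClosed ⦃γ : ℝ → 𝓑.carrier⦄ ⦃a b : ℝ⦄ (hab : a < b)
    (hγ : 𝓑.metric.IsFutureCausalCurveOn 𝓑.timeOrientation γ (Icc a b))
    (ha : γ a ∈ futureOpens 𝓑) : ∀ t ∈ Icc a b, γ t ∈ futureOpens 𝓑 :=
  forall_mem_chronologicalFuture_Mext 𝓑 hab hγ ha

/-- `I⁺(M_ext)` is invariant under the stationary flow. Chruściel–Costa 2008, §2.2. -/
theorem futureOpens_flowInvariant (γ : ℝ → 𝓑.carrier) (hγ : IsMIntegralCurve γ 𝓑.killing)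
    (h0 : γ 0 ∈ futureOpens 𝓑) (t : ℝ) : γ t ∈ futureOpens 𝓑 :=
  mem_chronologicalFuture_Mext_of_isMIntegralCurve 𝓑 hγ h0 t

/-- **`M_ext⁺` read in `M`** is the orbit of the embedded far piece `far (R + 2)`. -/
theorem image_val_Mext_eq :
    Subtype.val '' (futurePresentation 𝓑).Mext =
      stationaryOrbit 𝓑.killing
        (𝓑.embed '' (Subtype.val '' ((farEnd 𝓑).far ((farEnd 𝓑).R + 1)))) := by
  have himg : Subtype.val '' ((futurePresentation 𝓑).embed '' (farEnd 𝓑).far ((farEnd 𝓑).R + 1)) =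
      𝓑.embed '' (Subtype.val '' ((farEnd 𝓑).far ((farEnd 𝓑).R + 1))) := by
    rw [Set.image_image, Set.image_image]
  change Subtype.val '' stationaryOrbit (I := 𝓡 4)
      (fun y : futureOpens 𝓑 ↦ (𝓑.killing y.1 : TangentSpace (𝓡 4) y))
      ((futurePresentation 𝓑).embed '' (farEnd 𝓑).far ((farEnd 𝓑).R + 1)) = _
  rw [image_val_stationaryOrbit (futureOpens 𝓑) (futureOpens_flowInvariant 𝓑), himg]

/-- `M_ext⁺ ⊆ M_ext` (read in `M`): the far piece `far (R + 2)` lies in `far (R + 1)`. -/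
theorem image_val_Mext_subset : Subtype.val '' (futurePresentation 𝓑).Mext ⊆ 𝓑.Mext := by
  rw [image_val_Mext_eq]
  refine stationaryOrbit_mono 𝓑.killing (Set.image_mono ?_)
  rintro _ ⟨y, -, rfl⟩
  exact y.2

/-- `M_ext⁺` (read in `M`) is invariant under the stationary flow (it is an orbit). -/
theorem image_val_Mext_invariant (δ : ℝ → 𝓑.carrier) (hδ : IsMIntegralCurve δ 𝓑.killing)
    (h0 : δ 0 ∈ Subtype.val '' (futurePresentation 𝓑).Mext) (s : ℝ) :
    δ s ∈ Subtype.val '' (futurePresentation 𝓑).Mext := by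
  rw [image_val_Mext_eq] at h0 ⊢
  exact mem_stationaryOrbit_of_isMIntegralCurve_of_mem
    (𝓑.isStationaryKilling.isKillingField.contMDiff.of_le (by exact_mod_cast le_top)) hδ h0 s

/-- **`I⁺(M_ext⁺) = I⁺(M_ext)` in `M`.** Chruściel–Costa 2008, §3 (proof of Lemma 3.5). -/
theorem chronologicalFuture_image_val_Mext :
    𝓑.metric.chronologicalFuture 𝓑.timeOrientation (Subtype.val '' (futurePresentation 𝓑).Mext) =
      𝓑.metric.chronologicalFuture 𝓑.timeOrientation 𝓑.Mext :=
  chronologicalFuture_eq_of_invariant 𝓑 (image_val_Mext_subset 𝓑)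
    ((futurePresentation 𝓑).Mext_nonempty.image _) (image_val_Mext_invariant 𝓑)

/-- **`I⁻(M_ext⁺) = I⁻(M_ext)` in `M`.** Chruściel–Costa 2008, §3 (proof of Lemma 3.5). -/
theorem chronologicalPast_image_val_Mext :
    𝓑.metric.chronologicalPast 𝓑.timeOrientation (Subtype.val '' (futurePresentation 𝓑).Mext) =
      𝓑.metric.chronologicalPast 𝓑.timeOrientation 𝓑.Mext :=
  chronologicalPast_eq_of_invariant 𝓑 (image_val_Mext_subset 𝓑)
    ((futurePresentation 𝓑).Mext_nonempty.image _) (image_val_Mext_invariant 𝓑)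

/-- **`I⁺(M_ext⁺)` computed in `𝓑⁺` is `I⁺(M_ext)` read through the inclusion.** -/
theorem chronologicalFuture_Mext_futurePresentation :
    (futurePresentation 𝓑).metric.chronologicalFuture (futurePresentation 𝓑).timeOrientation
        (futurePresentation 𝓑).Mext =
      Subtype.val ⁻¹' 𝓑.metric.chronologicalFuture 𝓑.timeOrientation 𝓑.Mext := by
  change (𝓑.metric.restrict PseudoRiemannianMetric.contMDiff_restrict_holds
      (futureOpens 𝓑)).chronologicalFuture (𝓑.timeOrientation.restrict
        PseudoRiemannianMetric.contMDiff_restrict_holds 𝓑.timeOrientation.contMDiff_restrict_holds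
        (futureOpens 𝓑)) (futurePresentation 𝓑).Mext = _
  rw [chronologicalFuture_restrict_eq_preimage 𝓑.metric 𝓑.timeOrientation _ _
    (futureOpens_causallyClosed 𝓑), chronologicalFuture_image_val_Mext]

/-- **`I⁻(M_ext⁺)` computed in `𝓑⁺` is `I⁻(M_ext)` read through the inclusion.** -/
theorem chronologicalPast_Mext_futurePresentation :
    (futurePresentation 𝓑).metric.chronologicalPast (futurePresentation 𝓑).timeOrientation
        (futurePresentation 𝓑).Mext =
      Subtype.val ⁻¹' 𝓑.metric.chronologicalPast 𝓑.timeOrientation 𝓑.Mext := by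
  change (𝓑.metric.restrict PseudoRiemannianMetric.contMDiff_restrict_holds
      (futureOpens 𝓑)).chronologicalPast (𝓑.timeOrientation.restrict
        PseudoRiemannianMetric.contMDiff_restrict_holds 𝓑.timeOrientation.contMDiff_restrict_holds
        (futureOpens 𝓑)) (futurePresentation 𝓑).Mext = _
  rw [chronologicalPast_restrict_eq_preimage 𝓑.metric 𝓑.timeOrientation _ _
    (futureOpens_causallyClosed 𝓑), chronologicalPast_image_val_Mext]

/-- **The d.o.c. of `𝓑⁺` is that of `𝓑`** (read through the inclusion). -/
theorem doc_futurePresentation : (futurePresentation 𝓑).doc = Subtype.val ⁻¹' 𝓑.doc := by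
  change (futurePresentation 𝓑).metric.chronologicalFuture (futurePresentation 𝓑).timeOrientation
      (futurePresentation 𝓑).Mext ∩ (futurePresentation 𝓑).metric.chronologicalPast
      (futurePresentation 𝓑).timeOrientation (futurePresentation 𝓑).Mext =
    Subtype.val ⁻¹' (𝓑.metric.chronologicalFuture 𝓑.timeOrientation 𝓑.Mext ∩
      𝓑.metric.chronologicalPast 𝓑.timeOrientation 𝓑.Mext)
  rw [chronologicalFuture_Mext_futurePresentation, chronologicalPast_Mext_futurePresentation,
    preimage_inter]

/-- **The horizon of `𝓑⁺` is that of `𝓑`** (read through the inclusion). -/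
theorem horizon_futurePresentation : (futurePresentation 𝓑).horizon = Subtype.val ⁻¹' 𝓑.horizon := by
  change frontier ((futurePresentation 𝓑).metric.chronologicalPast
      (futurePresentation 𝓑).timeOrientation (futurePresentation 𝓑).Mext) ∩
      (futurePresentation 𝓑).metric.chronologicalFuture (futurePresentation 𝓑).timeOrientation
      (futurePresentation 𝓑).Mext =
    Subtype.val ⁻¹' (frontier (𝓑.metric.chronologicalPast 𝓑.timeOrientation 𝓑.Mext) ∩
      𝓑.metric.chronologicalFuture 𝓑.timeOrientation 𝓑.Mext)
  rw [chronologicalFuture_Mext_futurePresentation, chronologicalPast_Mext_futurePresentation]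
  change frontier (Subtype.val ⁻¹' _ : Set (futureOpens 𝓑)) ∩
      (Subtype.val ⁻¹' _ : Set (futureOpens 𝓑)) = _
  rw [frontier_preimage_val, preimage_inter]

omit [𝓑.metric.HasLeviCivita] in
/-- The d.o.c. lies in `I⁺(M_ext)`. -/
theorem doc_subset_futureOpens : 𝓑.doc ⊆ futureOpens 𝓑 := fun _ hp ↦ hp.1

/-! ## The four hypotheses pass to `𝓑⁺`; `𝓑⁺` is future-presented -/

/-- **Vacuum restricts**: `Ric(g|_{I⁺(M_ext)}) = 0` if `Ric(g) = 0`. O'Neill 1983, Ch. 3, Prop. 3.59. -/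
theorem isRicciFlat_futurePresentation (h1 : 𝓑.metric.toPseudoRiemannianMetric.IsRicciFlat) :
    (futurePresentation 𝓑).metric.toPseudoRiemannianMetric.IsRicciFlat := by
  have hvac : (dataEmbeddingFar 𝓑).IsVacuum := by
    intro inst
    exact h1
  haveI : ((dataEmbeddingFar 𝓑).metric.restrict PseudoRiemannianMetric.contMDiff_restrict_holds
      (futureOpens 𝓑)).toPseudoRiemannianMetric.HasLeviCivita :=
    hasLeviCivita_futurePresentation 𝓑
  exact (dataEmbeddingFar 𝓑).isRicciFlat_restrict (futureOpens 𝓑) hvac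

/-- **The horizon of `𝓑⁺` is connected** if that of `𝓑` is (it is its homeomorphic preimage
under the open embedding `ι`). -/
theorem isConnected_horizon_futurePresentation (h2 : IsConnected 𝓑.horizon) :
    IsConnected (futurePresentation 𝓑).horizon := by
  rw [horizon_futurePresentation]
  exact h2.preimage_of_isOpenMap Subtype.val_injective (futureOpens 𝓑).2.isOpenMap_subtype_val
    (by rw [Subtype.range_coe_subtype]; exact fun _ hp ↦ hp.2)

/-- **The horizon of `𝓑⁺` is a non-degenerate Killing horizon** if that of `𝓑` is: the horizon
Killing field `K` read on `I⁺(M_ext)` is a Killing field of `g|` with the same integral curves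
and `∇_{K|} K| = (∇_K K)|`. Chruściel–Costa 2008, §2.4–2.5. -/
theorem isNonDegenerateHorizon_futurePresentation
    (h3 : 𝓑.toSpacetime.IsNonDegenerateHorizon 𝓑.Mext) :
    (futurePresentation 𝓑).toSpacetime.IsNonDegenerateHorizon (futurePresentation 𝓑).Mext := by
  obtain ⟨K, hK, hne, hinv, κ, hκ, hLC⟩ := h3
  have hhor : (futurePresentation 𝓑).metric.futureEventHorizonOfEnd
      (futurePresentation 𝓑).timeOrientation (futurePresentation 𝓑).Mext =
        Subtype.val ⁻¹' 𝓑.horizon :=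
    horizon_futurePresentation 𝓑
  refine ⟨fun y ↦ (K y.1 : TangentSpace (𝓡 4) y), isKillingField_restrict 𝓑 (futureOpens 𝓑) hK,
    fun p hp ↦ ?_, fun γ hγ h0 t ↦ ?_, κ, hκ, fun p hp ↦ ?_⟩
  · rw [hhor] at hp
    exact hne p.1 hp
  · rw [hhor] at h0 ⊢
    exact hinv (Subtype.val ∘ γ) ((isMIntegralCurve_subtypeVal_comp_iff (futureOpens 𝓑)).2 hγ)
      h0 t
  · rw [hhor] at hp
    change (𝓑.metric.restrict PseudoRiemannianMetric.contMDiff_restrict_holds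
        (futureOpens 𝓑)).toPseudoRiemannianMetric.leviCivita
        (fun y : futureOpens 𝓑 ↦ (K y.1 : TangentSpace (𝓡 4) y)) p (K p.1) = κ • K p.1
    rw [leviCivita_restrict_apply 𝓑 (futureOpens 𝓑) hK.contMDiff]
    exact hLC p.1 hp

/-- **`𝓑⁺` is globally hyperbolic** if `𝓑` is. Hawking–Ellis 1973, §6.6. -/
theorem isGloballyHyperbolic_futurePresentation
    (h4 : 𝓑.metric.IsGloballyHyperbolic 𝓑.timeOrientation) :
    (futurePresentation 𝓑).metric.IsGloballyHyperbolic (futurePresentation 𝓑).timeOrientation :=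
  isGloballyHyperbolic_restrict 𝓑.metric 𝓑.timeOrientation _ _ (futureOpens_causallyClosed 𝓑) h4

/-- **`𝓑⁺` is future-presented**: every point of its carrier `I⁺(M_ext)` lies in `I⁺(M_ext⁺)`. -/
theorem mem_chronologicalFuture_Mext_futurePresentation (p : (futurePresentation 𝓑).carrier) :
    p ∈ (futurePresentation 𝓑).metric.chronologicalFuture (futurePresentation 𝓑).timeOrientation
      (futurePresentation 𝓑).Mext := by
  rw [chronologicalFuture_Mext_futurePresentation]
  exact p.2

/-- The inclusion `ι : I⁺(M_ext) → M` intertwines the stationary fields (`dι = id`). -/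
theorem mfderiv_val_killing (x : (futurePresentation 𝓑).carrier) :
    mfderiv (𝓡 4) (𝓡 4) (Subtype.val : (futurePresentation 𝓑).carrier → 𝓑.carrier) x
      ((futurePresentation 𝓑).killing x) = 𝓑.killing x.1 :=
  mfderiv_subtypeVal_apply (futureOpens 𝓑) x (𝓑.killing x.1)

/-- `ι(doc⁺) = doc`. -/
theorem image_val_doc : Subtype.val '' (futurePresentation 𝓑).doc = 𝓑.doc := by
  rw [doc_futurePresentation]
  exact image_val_preimage_val_of_subset (futureOpens 𝓑) (doc_subset_futureOpens 𝓑)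

/-- `ι(𝓔⁺⁺) = 𝓔⁺`. -/
theorem image_val_horizon : Subtype.val '' (futurePresentation 𝓑).horizon = 𝓑.horizon := by
  rw [horizon_futurePresentation]
  exact image_val_preimage_val_of_subset (futureOpens 𝓑) fun _ hp ↦ hp.2

end Summit.FinalStateConjecture.FinalStateConjecture.Theorems.ZeroEnergyRigidity.GlobalHorizonKillingField.FuturePresentation

/-! ## The registered stub -/

namespace Summit.FinalStateConjecture.FinalStateConjecture.Theorems.ZeroEnergyRigidity.GlobalHorizonKillingField

open Set Function Literature.Geometry.Lorentzian
open scoped Manifold ContDiff Topology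

/-- **Stub S1b · futurePresentation** (registered stub of crux stmt-FinalStateConjecture-10690,
line `global-horizon-killing-field`; residue S1b of `KerrOrBomb.Census.kerrOrBomb_of_residues`,
crux stmt-FinalStateConjecture-10689).  WLOG the carrier is `I⁺(M_ext)`: a vacuum presentation with
connected non-degenerate horizon and globally hyperbolic carrier restricts to the sub-carrier
`I⁺(M_ext)` as a presentation `𝓑⁺ = FuturePresentation.futurePresentation 𝓑` with the same four
hypotheses, FUTURE-PRESENTED, the inclusion `ι : 𝓑⁺ → 𝓑` being a smooth injective isometric
immersion with range `I⁺(M_ext)` which intertwines the stationary fields and maps `M_ext⁺` into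
`M_ext` and `doc⁺`, `𝓔⁺⁺` onto `doc`, `𝓔⁺`.  Chruściel–Costa 2008, §2.1–2.2 and Lemma 3.5;
O'Neill 1983, Ch. 14, Cor. 14.1 and p. 402; Hawking–Ellis 1973, §6.5–6.6. -/
theorem stub_futurePresentation :
    ∀ (𝓑 : StationaryAFBlackHole.{0}) [𝓑.metric.HasLeviCivita],
      𝓑.metric.toPseudoRiemannianMetric.IsRicciFlat → IsConnected 𝓑.horizon →
      𝓑.toSpacetime.IsNonDegenerateHorizon 𝓑.Mext →
      𝓑.metric.IsGloballyHyperbolic 𝓑.timeOrientation →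
        ∃ (𝓑' : StationaryAFBlackHole.{0}) (_ : 𝓑'.metric.HasLeviCivita),
          𝓑'.metric.toPseudoRiemannianMetric.IsRicciFlat ∧ IsConnected 𝓑'.horizon ∧
          𝓑'.toSpacetime.IsNonDegenerateHorizon 𝓑'.Mext ∧
          𝓑'.metric.IsGloballyHyperbolic 𝓑'.timeOrientation ∧
          (∀ p : 𝓑'.carrier, p ∈ 𝓑'.metric.chronologicalFuture 𝓑'.timeOrientation 𝓑'.Mext) ∧
          ∃ ι : 𝓑'.carrier → 𝓑.carrier, Function.Injective ι ∧
            Set.range ι = 𝓑.metric.chronologicalFuture 𝓑.timeOrientation 𝓑.Mext ∧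
            PseudoRiemannianMetric.IsIsometricImmersion 𝓑'.metric.toPseudoRiemannianMetric
              𝓑.metric.toPseudoRiemannianMetric ι ∧
            (∀ x, mfderiv (𝓡 4) (𝓡 4) ι x (𝓑'.killing x) = 𝓑.killing (ι x)) ∧
            ι '' 𝓑'.Mext ⊆ 𝓑.Mext ∧ ι '' 𝓑'.doc = 𝓑.doc ∧ ι '' 𝓑'.horizon = 𝓑.horizon := by
  intro 𝓑 _ h1 h2 h3 h4
  exact ⟨FuturePresentation.futurePresentation 𝓑, inferInstance,
    FuturePresentation.isRicciFlat_futurePresentation 𝓑 h1,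
    FuturePresentation.isConnected_horizon_futurePresentation 𝓑 h2,
    FuturePresentation.isNonDegenerateHorizon_futurePresentation 𝓑 h3,
    FuturePresentation.isGloballyHyperbolic_futurePresentation 𝓑 h4,
    FuturePresentation.mem_chronologicalFuture_Mext_futurePresentation 𝓑,
    Subtype.val, Subtype.val_injective, Subtype.range_coe_subtype,
    FuturePresentation.isIsometricImmersion_val 𝓑 (FuturePresentation.futureOpens 𝓑),
    FuturePresentation.mfderiv_val_killing 𝓑,
    FuturePresentation.image_val_Mext_subset 𝓑,
    FuturePresentation.image_val_doc 𝓑,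
    FuturePresentation.image_val_horizon 𝓑⟩

end Summit.FinalStateConjecture.FinalStateConjecture.Theorems.ZeroEnergyRigidity.GlobalHorizonKillingField

end
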